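import Mathlib.NumberTheory.Padics.PadicIntegers
import Mathlib.RingTheory.PowerSeries.Basic
import HarnessLib

/-!
# [telescope v20 — width seat bsd-line-x2-p2 g26, 2026-08-30] The member regularity clause (reg_k) OFF A FINITE SET of fibre values
# from the weight-two clause (reg₀) ALONE — generic algebra over `B = ℤ_p⟦X⟧⟦T⟧` (crux 4 `BSDpOnCellC`, stmt-BirchSwinnertonDyer-19034;
# `--supports`, helper; closes nothing)

WHY. In the registered composition (telescope v20, `Cruxes/BSDpOnCellC/Lines/telescope.lean` l.518–540) the member leaf N3F
requires, at every member `k` off a finite set of fibre VALUES `x_k`, the clause (reg_k)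
`∃ s : B, ¬ C (X − C x_k) ∣ s ∧ ∀ m : X₂, s • m = 0`, and obtains it (`TelescopeK2MemberControlOfModF.memberControl_of_mod`)
from the Keller–Yin 2024 Thm. 3.0.8 TORSION clause `thm308_imc2_hidaMember_isTorsion_OPEN` (conjunct 4 of `stub_preprintFacts`)
through N3″'s torsion transfer and Cayley–Hamilton. But the weight-two leaf N2 already supplies (reg₀)
`∃ s : B, ¬ C X ∣ s ∧ ∀ m : X₂, s • m = 0` for the SAME module `X₂` (conclusion of
`TelescopeK2WeightTwoControlOfPubOfPseudoNullT.weightTwoControlOfPub_of_pseudoNull`, threaded as `h2'.2.1` in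
`TelescopeK2ModuleDivOfLeavesFPG.branchFibreDiv_of_leaves`), and the SAME `s` witnesses (reg_k) at every `k` with
`¬ C (X − C x_k) ∣ s`. This file proves that the exceptional `k` have fibre values in a FINITE set, by constant coefficients only:
`C q ∣ s ↔ q` divides every `T`-coefficient; `¬ C X ∣ s` gives a `T`-coefficient `s_{i₀}` with `s_{i₀}(0) ≠ 0`;
`(X − C z) ∣ g ⇒ ‖g(0)‖ ≤ ‖z‖`; and `x_k → 0` leaves only finitely many `k` with `‖x_k‖ ≥ ‖s_{i₀}(0)‖`.
CONSEQUENCE (sibling files): the torsion clause is NOT NEEDED by the composition — `stub_preprintFacts` can cite KY24 ×3 instead of ×4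
(by-name register 28 → 27); the glue is `TelescopeK2ModuleDivOfLeavesFPGM.branchFibreDiv_of_leaves_of_modCofinite`.

HONEST FRAMING: elementary commutative algebra / `p`-adic analysis; no Selmer group, no stub, no crux, no summit statement is proved;
BSD is proved for no curve. THEOREMS ONLY (no definition, no named fact, no `sorry`, no instance, no notation). [folklore]
-/

set_option autoImplicit false
set_option linter.dupNamespace false

noncomputable section

namespace Summit.BirchSwinnertonDyer.BirchSwinnertonDyer.Theorems.TelescopeK2MemberRegOffFinite

open PowerSeries Filter

variable {A : Type*} [CommRing A]

/-- In `A⟦T⟧`, a constant `C q` divides `s` iff `q` divides every `T`-coefficient of `s`. [folklore] -/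
theorem C_dvd_iff_forall_dvd_coeff (q : A) (s : PowerSeries A) :
    (PowerSeries.C q : PowerSeries A) ∣ s ↔ ∀ i : ℕ, q ∣ PowerSeries.coeff i s := by
  constructor
  · rintro ⟨u, rfl⟩ i
    exact ⟨PowerSeries.coeff i u, by rw [PowerSeries.coeff_C_mul]⟩
  · intro h
    choose u hu using h
    refine ⟨PowerSeries.mk u, ?_⟩
    ext i
    rw [PowerSeries.coeff_C_mul, PowerSeries.coeff_mk, hu i]

/-- `¬ C X ∣ s` in `A⟦X⟧⟦T⟧` gives a `T`-coefficient of `s` with non-zero constant term. [folklore] -/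
theorem exists_constantCoeff_coeff_ne_zero (s : PowerSeries (PowerSeries A))
    (hs : ¬ (PowerSeries.C (PowerSeries.X : PowerSeries A) : PowerSeries (PowerSeries A)) ∣ s) :
    ∃ i₀ : ℕ, PowerSeries.constantCoeff (PowerSeries.coeff i₀ s) ≠ 0 := by
  by_contra hcon
  push Not at hcon
  exact hs ((C_dvd_iff_forall_dvd_coeff _ _).2 fun i => PowerSeries.X_dvd_iff.2 (hcon i))

/-- If `(X − C z) ∣ g` in `ℤ_p⟦X⟧` then `‖g(0)‖ ≤ ‖z‖` (`g(0) = −z · h(0)` and `‖h(0)‖ ≤ 1`). [folklore] -/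
theorem norm_constantCoeff_le_of_X_sub_C_dvd {p : ℕ} [Fact p.Prime] (z : ℤ_[p]) (g : PowerSeries ℤ_[p])
    (h : (PowerSeries.X - PowerSeries.C z : PowerSeries ℤ_[p]) ∣ g) :
    ‖PowerSeries.constantCoeff g‖ ≤ ‖z‖ := by
  obtain ⟨u, rfl⟩ := h
  simp only [map_mul, map_sub, PowerSeries.constantCoeff_X, PowerSeries.constantCoeff_C, zero_sub, neg_mul,
    norm_neg, norm_mul]
  exact mul_le_of_le_one_right (norm_nonneg _) (PadicInt.norm_le_one _)

/-- **(reg_k) off a finite set of fibre values, from (reg₀)'s witness.** For `x : ℕ → ℤ_p` with `x_k → 0` and `s ∈ ℤ_p⟦X⟧⟦T⟧` with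
`¬ C X ∣ s` there is a FINITE `bad ⊆ ℤ_p` such that `¬ C (X − C x_k) ∣ s` whenever `x_k ∉ bad`
(`bad = {x_k : ‖x_k‖ ≥ ‖s_{i₀}(0)‖}`). [folklore] -/
theorem exists_finite_forall_not_C_X_sub_C_dvd {p : ℕ} [Fact p.Prime] (x : ℕ → ℤ_[p])
    (s : PowerSeries (PowerSeries ℤ_[p])) (hx : Tendsto x atTop (nhds 0))
    (hs : ¬ (PowerSeries.C (PowerSeries.X : PowerSeries ℤ_[p]) : PowerSeries (PowerSeries ℤ_[p])) ∣ s) :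
    ∃ bad : Set ℤ_[p], bad.Finite ∧ ∀ k : ℕ, x k ∉ bad →
      ¬ (PowerSeries.C (PowerSeries.X - PowerSeries.C (x k)) : PowerSeries (PowerSeries ℤ_[p])) ∣ s := by
  obtain ⟨i₀, hi₀⟩ := exists_constantCoeff_coeff_ne_zero s hs
  have hc₀ : 0 < ‖PowerSeries.constantCoeff (PowerSeries.coeff i₀ s)‖ := norm_pos_iff.2 hi₀
  obtain ⟨N₀, hN₀⟩ : ∃ N₀ : ℕ, ∀ k ≥ N₀, ‖x k‖ < ‖PowerSeries.constantCoeff (PowerSeries.coeff i₀ s)‖ := by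
    have h := (Metric.tendsto_atTop.1 hx) _ hc₀
    simpa only [dist_zero_right] using h
  refine ⟨x '' {k : ℕ | ‖PowerSeries.constantCoeff (PowerSeries.coeff i₀ s)‖ ≤ ‖x k‖}, ?_, ?_⟩
  · refine (Set.Finite.subset (Set.finite_Iio N₀) ?_).image x
    intro k hk
    by_contra hk'
    exact (not_lt.2 hk) (hN₀ k (not_lt.1 hk'))
  · intro k hk hdvd
    exact hk ⟨k, norm_constantCoeff_le_of_X_sub_C_dvd (x k) _ ((C_dvd_iff_forall_dvd_coeff _ _).1 hdvd i₀), rfl⟩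

/-- **The member regularity clauses from the weight-two one, packaged.** If `s ∈ ℤ_p⟦X⟧⟦T⟧` with `¬ C X ∣ s` kills a module `X₂`
(any scalar action) and `x_k → 0`, then off a finite set of fibre values the SAME `s` witnesses
`∃ s, ¬ C (X − C x_k) ∣ s ∧ ∀ m, s • m = 0`. [folklore] -/
theorem exists_finite_forall_reg {p : ℕ} [Fact p.Prime] {M : Type*} [SMul (PowerSeries (PowerSeries ℤ_[p])) M] [Zero M]
    (x : ℕ → ℤ_[p]) (hx : Tendsto x atTop (nhds 0))
    (hreg : ∃ s : PowerSeries (PowerSeries ℤ_[p]),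
      ¬ (PowerSeries.C (PowerSeries.X : PowerSeries ℤ_[p]) ∣ s) ∧ ∀ m : M, s • m = 0) :
    ∃ bad : Set ℤ_[p], bad.Finite ∧ ∀ k : ℕ, x k ∉ bad →
      ∃ s : PowerSeries (PowerSeries ℤ_[p]),
        ¬ (PowerSeries.C (PowerSeries.X - PowerSeries.C (x k)) ∣ s) ∧ ∀ m : M, s • m = 0 := by
  obtain ⟨s, hs, hkill⟩ := hreg
  obtain ⟨bad, hbad, h⟩ := exists_finite_forall_not_C_X_sub_C_dvd x s hx hs
  exact ⟨bad, hbad, fun k hk => ⟨s, h k hk, hkill⟩⟩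

end Summit.BirchSwinnertonDyer.BirchSwinnertonDyer.Theorems.TelescopeK2MemberRegOffFinite

end
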